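import Literature.AnabelianGeometry.AbsoluteAnabelian.MonoidKummerGaloisCyclotomeHomNaturality
import Literature.AnabelianGeometry.AbsoluteAnabelian.GaloisCyclotomeRestrictionCompat
import HarnessLib

/-!
# [AbsTopIII] Prop 3.2 (ii) / Rmk 3.2.1 with `μ_Ẑ(G)`-coefficients along the RESTRICTION MORPHISMS
# `(Π′ ↷ 𝒪_k̄^⊳) → (Π ↷ 𝒪_k̄^⊳)` of a finite extension `k′/k`: the coefficient square for THE data

S. Mochizuki, *Topics in Absolute Anabelian Geometry III*, §3 (bib key `MochizukiAbsTopIII2015`):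
Def. 3.1 (ii) p. 67 (morphisms «induce an open injective homomorphism between the respective arithmetic
Galois groups» — the basic example: the restriction to a finite extension `k′/k` inside `k̄`), Prop. 3.2
(ii) p. 71–72 («functorial algorithm … «`μ_Ẑ(M_TM)`» may be replaced by «`μ_Ẑ(G)`»»), Rmk. 3.2.1 /
3.2.2 p. 73, Cor. 1.10 (i) p. 42; [AbsAnab] Prop. 1.2.1 (vi)/(vii) pp. 10–11 («by the Verlagerung»; bib key
`MochizukiAbsAnab2004`).

THE POINT (abc-iut cell, layer L4, row «P32ii-MUZHAT-HOM-NAT», residual named by abc-iut-L4-t2 at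
12:14Z: the coefficient square of `MonoidKummerGaloisCyclotomeHomNaturality.lean` (p443542) for the
FIELD-RESTRICTION morphisms with THE reciprocity data).  Setting: two closure data `C₁ = (E, Ē)`,
`C₂ = (F, F̄)` with `E/F` a finite extension of MLFs whose valuation prolongs that of `F`
(`[Algebra F E] [FiniteDimensional F E] [ValuativeExtension F E]` — abc-iut-L4-t11's setting), an
`F`-isomorphism of the closures `j : Ē ≃ₐ[F] F̄`, model data `D₁` over `(E, Ē)`, `D₂` over `(F, F̄)`, and a
morphism of model `TM`-pairs `φ : (Π₁ ↷ 𝒪_Ē^⊳) → (Π₂ ↷ 𝒪_F̄^⊳)` that is a RESTRICTION morphism along `j`: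
`φ_M = j` on elements (`hφM`) and `φ_Π` covers `σ ↦ j ∘ σ ∘ j⁻¹ : Aut_E(Ē) ↪ Aut_F(F̄)` (`haug`) — e.g. `Ē = F̄ = k̄`,
`j = 𝟙`, `E = k′ ⊇ k = F` inside `k̄`: print's basic morphism of Def. 3.1 (ii).  For such `φ`:

* `GaloisMonoidPair.Hom.closureTwist` — the inner automorphism `γ₀ ∈ G_F` relating the chosen identifications
  of algebraic closures, `γ₀ = (F̄ ≃ F^alg) ∘ j ∘ (Ē ≃ E^alg)⁻¹ ∘ ι` (`ι : F^alg → E^alg` the chosen embedding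
  `absClosureEmbedding`); **`absGaloisHom_eq_conj_absGaloisRestrict`** — on Mathlib's absolute Galois groups the
  covered open injection `β` IS abc-iut's `absGaloisRestrict F E` (Literature/NumberTheory) UP TO `conj_{γ₀}`
  (identifications of algebraic closures are only well defined up to such a `γ₀`; it is carried explicitly);
* `muQZ.mapOfOpenEmbedding_conj` — `μ_{ℚ/ℤ}(conj_γ ∘ f) = (γ • ·) ∘ μ_{ℚ/ℤ}(f)` (abc-iut-w5-d201's
  `mapOfOpenEmbedding` on representatives, `exists_mapOfOpenEmbedding_ofRep`);
* **`GaloisMonoidPair.Hom.coeffSquare_restrict`** — THE COEFFICIENT SQUARE for restriction morphisms and THE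
  data: `Λ(rootsHom_{C₂} (fundamental F)) ∘ μ_Ẑ(β) = Λ(φ_M^gp) ∘ Λ(rootsHom_{C₁} (fundamental E))` — from
  abc-iut-L4-t11's restriction compatibility of THE identifications `Cor110Open.fundamental_equiv_restrict_compat`
  (p442621, «by the Verlagerung») and `G_F`-equivariance (`TorsionReciprocityData.equiv_smul`) absorbing `γ₀`;
* **`GaloisMonoidPair.Hom.pullMuZhat_kummerMuZhat_eq_pushMuZhat_restrict`** — hence, UNCONDITIONALLY for THE
  data: `φ_Π^* κ^G_{H₂}(φ_M m) = μ_Ẑ(β)_* κ^G_{H₁}(m)` along every restriction morphism — (ii)'s analogue of the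
  L07 functoriality «relative to `𝒞^MLF_T`» for restrictions, complementing the isomorphism case (p441742) and
  the negative along `powEnd` (p443542).

One small DATA definition (`closureTwist`); everything else theorems.  Universe `0`.  HONEST FRAMING:
classical local class field theory / Kummer theory as proved in the tree; nothing here bears on [IUTchIII]
Cor. 3.12; no side is taken; nothing asserts that abc is proved or refuted.
-/

noncomputable section

open scoped nonZeroDivisors

namespace Literature.AnabelianGeometry.AbsoluteAnabelian

open _root_.CategoryTheory groupCohomology _root_.ValuativeRel Field
open Literature.NumberTheory.GaloisRepresentations

/-! ### §1 `μ_{ℚ/ℤ}` of an open embedding composed with an inner automorphism -/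

section MapConj

variable {G : Type} [Group G] [TopologicalSpace G] [IsTopologicalGroup G] [CompactSpace G]
  {G' : Type} [Group G'] [TopologicalSpace G'] [IsTopologicalGroup G'] [CompactSpace G'] [T2Space G']

/-- `μ_{ℚ/ℤ}(f)` on representatives: `[u ∈ U] ↦ [f u ∈ f(U)]` (`muQZ.mapOfOpenEmbedding` = transport along
`G ≅ f(G)` then the open-subgroup comparison, both explicit on representatives).
[cite: MochizukiAbsTopIII2015, Cor 1.10 (i) p.42] -/
theorem muQZ.exists_mapOfOpenEmbedding_ofRep (f : G →ₜ* G') (hinj : Function.Injective f)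
    (hf : IsOpen (Set.range f)) (U : OpenSubgroup G) (u : G) (hu : u ∈ U) (ht) :
    ∃ (hA : f u ∈ osMap (rangeOpenSubgroup f hf) (imageOpenSubgroup (equivRangeOfInjective f hinj hf) U))
      (htA : (QuotientGroup.mk (⟨f u, hA⟩ :
          (osMap (rangeOpenSubgroup f hf) (imageOpenSubgroup (equivRangeOfInjective f hinj hf) U) : Subgroup G')) :
          TopologicalAbelianization (osMap (rangeOpenSubgroup f hf)
            (imageOpenSubgroup (equivRangeOfInjective f hinj hf) U) : Subgroup G')) ∈
        abelianizationTorsion (osMap (rangeOpenSubgroup f hf)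
          (imageOpenSubgroup (equivRangeOfInjective f hinj hf) U) : Subgroup G')),
      muQZ.mapOfOpenEmbedding f hinj hf (muQZ.ofRep U u hu ht) =
        muQZ.ofRep (osMap (rangeOpenSubgroup f hf) (imageOpenSubgroup (equivRangeOfInjective f hinj hf) U))
          (f u) hA htA := by
  have key : muQZ.mapOfOpenEmbedding f hinj hf (muQZ.ofRep U u hu ht) =
      muQZ.restrictOpen (rangeOpenSubgroup f hf)
        (muQZ.map (equivRangeOfInjective f hinj hf) (muQZ.ofRep U u hu ht)) := rfl
  rw [muQZ.map_ofRep, muQZ.restrictOpen_ofRep] at key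
  exact ⟨_, _, key⟩

omit [IsTopologicalGroup G] [IsTopologicalGroup G'] [CompactSpace G'] in
/-- Membership in `f(U)† ⊆ G'`: `g ∈ f(U)†` iff `g = f x` for some `x ∈ U`.
[cite: MochizukiAbsTopIII2015, Cor 1.10 (i) p.42] -/
theorem mem_osMap_imageOpenSubgroup_equivRange_iff (f : G →ₜ* G') (hinj : Function.Injective f)
    (hf : IsOpen (Set.range f)) (U : OpenSubgroup G) (g : G') :
    g ∈ osMap (rangeOpenSubgroup f hf) (imageOpenSubgroup (equivRangeOfInjective f hinj hf) U) ↔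
      ∃ x ∈ U, f x = g := by
  rw [mem_osMap_iff]
  constructor
  · rintro ⟨hg, hgU⟩
    change (equivRangeOfInjective f hinj hf).symm ⟨g, hg⟩ ∈ U at hgU
    refine ⟨(equivRangeOfInjective f hinj hf).symm ⟨g, hg⟩, hgU, ?_⟩
    exact congrArg Subtype.val ((equivRangeOfInjective f hinj hf).apply_symm_apply ⟨g, hg⟩)
  · rintro ⟨x, hxU, rfl⟩
    refine ⟨⟨x, rfl⟩, ?_⟩
    change (equivRangeOfInjective f hinj hf).symm ⟨f x, ⟨x, rfl⟩⟩ ∈ U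
    have hs : (equivRangeOfInjective f hinj hf).symm ⟨f x, ⟨x, rfl⟩⟩ = x :=
      (equivRangeOfInjective f hinj hf).injective (by
        rw [ContinuousMulEquiv.apply_symm_apply]
        exact Subtype.ext rfl)
    rw [hs]
    exact hxU

/-- **`μ_{ℚ/ℤ}(conj_γ ∘ f) = (γ • ·) ∘ μ_{ℚ/ℤ}(f)`** for injective open-range `f, f′ : G → G′` with
`f′ = γ f γ⁻¹` (both sides are explicit on representatives `[u ∈ U] ↦ [f u ∈ f(U)]`).
[cite: MochizukiAbsTopIII2015, Cor 1.10 (i) p.42] -/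
theorem muQZ.mapOfOpenEmbedding_conj (f f' : G →ₜ* G') (hinj : Function.Injective f) (hf : IsOpen (Set.range f))
    (hinj' : Function.Injective f') (hf' : IsOpen (Set.range f')) (γ : G') (hγ : ∀ x, f' x = γ * f x * γ⁻¹)
    (z : muQZ G) :
    muQZ.mapOfOpenEmbedding f' hinj' hf' z = γ • muQZ.mapOfOpenEmbedding f hinj hf z := by
  obtain ⟨U, u, hu, ht, rfl⟩ := muQZ.exists_ofRep z
  obtain ⟨hA', htA', h'⟩ := muQZ.exists_mapOfOpenEmbedding_ofRep f' hinj' hf' U u hu ht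
  obtain ⟨hA, htA, h⟩ := muQZ.exists_mapOfOpenEmbedding_ofRep f hinj hf U u hu ht
  rw [h', h, muQZ.smul_ofRep]
  refine muQZ.ofRep_congr ?_ ?_
  · ext g
    rw [mem_osMap_imageOpenSubgroup_equivRange_iff, mem_imageOpenSubgroup_conj_iff,
      mem_osMap_imageOpenSubgroup_equivRange_iff]
    constructor
    · rintro ⟨x, hxU, rfl⟩
      exact ⟨x, hxU, by rw [hγ]; group⟩
    · rintro ⟨x, hxU, hx⟩
      refine ⟨x, hxU, ?_⟩
      rw [hγ, hx]
      group
  · rw [hγ, conjContinuousMulEquiv_apply]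

end MapConj

/-! ### §2 Restriction morphisms of model `TM`-pairs along `j : Ē ≃ F̄` and their covered `β` -/

namespace GaloisMonoidPair.Hom

variable {C₁ C₂ : MLFClosure.{0}} [Algebra C₂.k C₁.k] [FiniteDimensional C₂.k C₁.k]
  [Algebra C₂.k C₁.K] [IsScalarTower C₂.k C₁.k C₁.K]
  (j : C₁.K ≃ₐ[C₂.k] C₂.K)
  {D₁ : ModelMLFGaloisData C₁.k C₁.K} {D₂ : ModelMLFGaloisData C₂.k C₂.K}
  (φ : GaloisMonoidPair.Hom D₁.tmPair D₂.tmPair)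
  (haug : ∀ (g : D₁.Pi) (x : C₁.K), D₂.aug (φ.homPi g) (j x) = j (D₁.aug g x))

omit [Algebra C₂.k C₁.k] [FiniteDimensional C₂.k C₁.k] [IsScalarTower C₂.k C₁.k C₁.K] in
include haug in
/-- For a restriction morphism the covered `β` is `σ ↦ j ∘ σ ∘ j⁻¹` (for `j = 𝟙`: the inclusion
`Aut_E(k̄) ↪ Aut_F(k̄)`). [cite: MochizukiAbsTopIII2015, Definition 3.1 (ii) p.67] -/
theorem galoisHom_apply (σ : C₁.K ≃ₐ[C₁.k] C₁.K) (y : C₂.K) : φ.galoisHom σ y = j (σ (j.symm y)) := by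
  obtain ⟨g, rfl⟩ := D₁.aug_surjective σ
  obtain ⟨x, rfl⟩ := j.surjective y
  rw [galoisHom_aug, haug, AlgEquiv.symm_apply_apply]

/-- The inner automorphism `γ₀ ∈ G_F` relating the chosen identifications of algebraic closures:
`γ₀ = (F̄ ≃ F^alg) ∘ j ∘ (Ē ≃ E^alg)⁻¹ ∘ ι`, `ι : F^alg → E^alg` the chosen embedding (`absClosureEmbedding`).
[cite: MochizukiAbsTopIII2015, Definition 3.1 (i) p.66] -/
def closureTwist : absoluteGaloisGroup C₂.k :=
  AlgEquiv.ofBijective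
    { toRingHom := (C₂.toAlgClosure : C₂.K ≃ₐ[C₂.k] AlgebraicClosure C₂.k).toRingHom.comp
        ((j : C₁.K ≃ₐ[C₂.k] C₂.K).toRingHom.comp
          (((C₁.toAlgClosure.symm : AlgebraicClosure C₁.k ≃ₐ[C₁.k] C₁.K)).toRingHom.comp
            (absClosureEmbedding C₂.k C₁.k).toRingHom))
      commutes' := fun a => by
        change C₂.toAlgClosure (j (C₁.toAlgClosure.symm
          (absClosureEmbedding C₂.k C₁.k (algebraMap C₂.k (AlgebraicClosure C₂.k) a)))) =
            algebraMap C₂.k (AlgebraicClosure C₂.k) a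
        rw [AlgHom.commutes, IsScalarTower.algebraMap_apply C₂.k C₁.k (AlgebraicClosure C₁.k),
          AlgEquiv.commutes, ← IsScalarTower.algebraMap_apply, AlgEquiv.commutes, AlgEquiv.commutes] }
    (Algebra.IsAlgebraic.algHom_bijective _)

omit [FiniteDimensional C₂.k C₁.k] in
/-- `γ₀ • x = (F̄ ≃ F^alg) (j ((Ē ≃ E^alg)⁻¹ (ι x)))`. [cite: MochizukiAbsTopIII2015, Definition 3.1 (i) p.66] -/
theorem closureTwist_smul (x : AlgebraicClosure C₂.k) :
    closureTwist j • x = C₂.toAlgClosure (j (C₁.toAlgClosure.symm (absClosureEmbedding C₂.k C₁.k x))) := by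
  rw [Field.absoluteGaloisGroup.smul_def]
  rfl

omit [FiniteDimensional C₂.k C₁.k] in
/-- `(F̄ ≃ F^alg)⁻¹ (γ₀ • x) = j ((Ē ≃ E^alg)⁻¹ (ι x))`. [cite: MochizukiAbsTopIII2015, Definition 3.1 (i) p.66] -/
theorem toAlgClosure_symm_closureTwist_smul (x : AlgebraicClosure C₂.k) :
    C₂.toAlgClosure.symm (closureTwist j • x) = j (C₁.toAlgClosure.symm (absClosureEmbedding C₂.k C₁.k x)) := by
  rw [closureTwist_smul, AlgEquiv.symm_apply_apply]

omit [FiniteDimensional C₂.k C₁.k] in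
include haug in
/-- **`β = conj_{γ₀} ∘ res` on Mathlib's absolute Galois groups**: the covered open injection of a restriction
morphism is abc-iut's `absGaloisRestrict F E` up to the inner automorphism by `γ₀`.
[cite: MochizukiAbsTopIII2015, Definition 3.1 (ii) p.67] -/
theorem absGaloisHom_eq_conj_absGaloisRestrict (h₁ : IsOpenMap D₁.aug) (σ : absoluteGaloisGroup C₁.k) :
    φ.absGaloisHom h₁ σ = closureTwist j * absGaloisRestrict C₂.k C₁.k σ * (closureTwist j)⁻¹ := by
  obtain ⟨g, rfl⟩ := GaloisMonoidPair.Iso.augGal_surjective C₁ D₁ σ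
  rw [absGaloisHom_augGal]
  apply FaithfulSMul.eq_of_smul_eq_smul (α := AlgebraicClosure C₂.k)
  intro x
  -- write `x = γ₀ • y`
  obtain ⟨y, rfl⟩ : ∃ y, closureTwist j • y = x := ⟨(closureTwist j)⁻¹ • x, smul_inv_smul _ _⟩
  rw [mul_smul, mul_smul, inv_smul_smul, ModelMLFGaloisData.augGal_smul, toAlgClosure_symm_closureTwist_smul,
    haug, closureTwist_smul, absGaloisRestrict_apply_smul, ModelMLFGaloisData.augGal_smul,
    AlgEquiv.symm_apply_apply]

/-! ### §3 The coefficient square for restriction morphisms and THE data -/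

variable (hφM : ∀ m : nonzeroIntegers C₁.k C₁.K, ((φ.homM m : nonzeroIntegers C₂.k C₂.K) : C₂.K) = j (m : C₁.K))

omit [Algebra C₂.k C₁.k] [FiniteDimensional C₂.k C₁.k] [IsScalarTower C₂.k C₁.k C₁.K] in
include hφM in
/-- For a restriction morphism `φ_M^gp = j` on units. [cite: MochizukiAbsTopIII2015, Definition 3.1 (iii) p.68] -/
theorem unitsLift_eq_of_restrict :
    ModelMLFGaloisData.unitsLift φ.homM = Units.map (j : C₁.K →* C₂.K) :=
  (ModelMLFGaloisData.unitsLift_unique φ.homM (Units.map (j : C₁.K →* C₂.K)) fun m =>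
    Units.ext (by rw [Units.coe_map, MonoidHom.coe_coe]; exact (hφM m).symm)).symm

variable [ValuativeExtension C₂.k C₁.k]

include haug hφM in
/-- **THE COEFFICIENT SQUARE FOR RESTRICTION MORPHISMS** (`hsq` of `MonoidKummerGaloisCyclotomeHomNaturality`
with THE data): `Λ(rootsHom_{C₂} (fundamental F)) (μ_Ẑ(β) ζ) = Λ(φ_M^gp) (Λ(rootsHom_{C₁} (fundamental E)) ζ)` for
every `ζ ∈ μ_Ẑ(G_E)` — abc-iut-L4-t11's `Cor110Open.fundamental_equiv_restrict_compat` («by the Verlagerung»)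
composed with the `γ₀`-twist (`TorsionReciprocityData.equiv_smul`, `muQZ.mapOfOpenEmbedding_conj`).
[cite: MochizukiAbsAnab2004, Prop 1.2.1 (vi) p.10] -/
theorem coeffSquare_restrict (h₁ : IsOpenMap D₁.aug) (h₂ : IsOpenMap D₂.aug) (ζ : muZhat (absoluteGaloisGroup C₁.k)) :
    EtaleTheta.cyclotome.map (ModelMLFGaloisData.rootsHom C₂ (TorsionReciprocityData.fundamental C₂.k))
        (φ.muZhatMap h₁ h₂ ζ) =
      EtaleTheta.cyclotome.map (ModelMLFGaloisData.unitsLift φ.homM)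
        (EtaleTheta.cyclotome.map (ModelMLFGaloisData.rootsHom C₁ (TorsionReciprocityData.fundamental C₁.k)) ζ) := by
  rw [φ.unitsLift_eq_of_restrict j hφM]
  refine Subtype.ext (funext fun n => Units.ext ?_)
  rw [EtaleTheta.cyclotome.map_apply, EtaleTheta.cyclotome.map_apply, EtaleTheta.cyclotome.map_apply,
    ModelMLFGaloisData.coe_rootsHom, Units.coe_map, MonoidHom.coe_coe, ModelMLFGaloisData.coe_rootsHom,
    muZhatMap, muZhat.coe_mapOfOpenEmbedding_apply, toAdd_ofAdd]
  set w : muQZ (absoluteGaloisGroup C₁.k) :=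
    Multiplicative.toAdd ((ζ : ℕ+ → Multiplicative (muQZ (absoluteGaloisGroup C₁.k))) n) with hw
  -- `μ_{ℚ/ℤ}(β) w = γ₀ • μ_{ℚ/ℤ}(res) w`
  have hβ : muQZ.mapOfOpenEmbedding (φ.absGaloisHom h₁) (φ.absGaloisHom_injective h₁)
        (φ.isOpen_range_absGaloisHom h₁ h₂) w =
      closureTwist j • muQZ.mapOfOpenEmbedding (absGaloisRestrict C₂.k C₁.k)
        (absGaloisRestrict_injective C₂.k C₁.k) (isOpen_range_absGaloisRestrict C₂.k C₁.k) w :=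
    muQZ.mapOfOpenEmbedding_conj _ _ _ _ _ _ (closureTwist j)
      (fun σ => φ.absGaloisHom_eq_conj_absGaloisRestrict j haug h₁ σ) w
  rw [hβ, TorsionReciprocityData.equiv_smul, toAlgClosure_symm_closureTwist_smul]
  -- abc-iut-L4-t11's restriction compatibility of THE identifications, at `z := μ_{ℚ/ℤ}(res) w`
  have key := Cor110Open.fundamental_equiv_restrict_compat C₂.k C₁.k
    (muQZ.mapOfOpenEmbedding (absGaloisRestrict C₂.k C₁.k)
      (absGaloisRestrict_injective C₂.k C₁.k) (isOpen_range_absGaloisRestrict C₂.k C₁.k) w)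
  rw [AddEquiv.symm_apply_apply] at key
  rw [key]

include haug hφM in
/-- **[AbsTopIII] Prop 3.2 (ii) with `μ_Ẑ(G)`-coefficients along RESTRICTION MORPHISMS, UNCONDITIONALLY for
THE data.**  For a restriction morphism `φ : (Π₁ ↷ 𝒪_Ē^⊳) → (Π₂ ↷ 𝒪_F̄^⊳)` along `j : Ē ≃ F̄` of model MLF-Galois
`TM`-pairs (`E/F` finite, open augmentations), open `H₁ ⊆ Π₁`, `H₂ ⊆ Π₂` with `φ_Π(H₁) ⊆ H₂`, and
`m ∈ (𝒪_Ē^⊳)^{H₁}`: `φ_Π^* (κ^G_{H₂}(φ_M m)) = μ_Ẑ(β)_* (κ^G_{H₁}(m))` — the `μ_Ẑ(G)`-valued Kummer maps built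
from THE reciprocity data are natural along the restriction morphisms, the coefficient identification being
the GROUP-THEORETIC `μ_Ẑ(β)` of Cor. 1.10 (i).  [cite: MochizukiAbsTopIII2015, Proposition 3.2 (ii) p.72] -/
theorem pullMuZhat_kummerMuZhat_eq_pushMuZhat_restrict (h₁ : IsOpenMap D₁.aug) (h₂ : IsOpenMap D₂.aug)
    {H₁ : OpenSubgroup D₁.tmPair.Pi} {H₂ : OpenSubgroup D₂.tmPair.Pi}
    (hH : (H₁ : Subgroup D₁.Pi).map φ.homPi ≤ (H₂ : Subgroup D₂.Pi))
    (m : {m : D₁.tmPair.M // ∀ h : H₁, (h : D₁.tmPair.Pi) • m = m})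
    (hm : ∀ h : H₂, (h : D₂.tmPair.Pi) • φ.homM m.1 = φ.homM m.1) :
    φ.pullMuZhat (TorsionReciprocityData.fundamental C₂.k) hH
        (ModelMLFGaloisData.kummerMuZhat C₂ D₂ (TorsionReciprocityData.fundamental C₂.k) H₂ ⟨φ.homM m.1, hm⟩) =
      φ.pushMuZhat h₁ h₂ (TorsionReciprocityData.fundamental C₁.k) (TorsionReciprocityData.fundamental C₂.k) hH
        (ModelMLFGaloisData.kummerMuZhat C₁ D₁ (TorsionReciprocityData.fundamental C₁.k) H₁ m) :=
  φ.pullMuZhat_kummerMuZhat_eq_pushMuZhat_of_square h₁ h₂ _ _ hH (φ.coeffSquare_restrict j haug hφM h₁ h₂) m hm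

end GaloisMonoidPair.Hom

end Literature.AnabelianGeometry.AbsoluteAnabelian

end
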